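import Summits.BirchSwinnertonDyer.BirchSwinnertonDyer.Theorems.SignedLowerHalvesKobayashiLowerHalfLargeImageSignDefectX7
import Summits.BirchSwinnertonDyer.BirchSwinnertonDyer.Theses.SignedLowerHalves
import HarnessLib

/-!
# Crux `KobayashiLowerHalfLargeImage` (route `SignedLowerHalves`, item 3 = stmt-BirchSwinnertonDyer-19001) BY NAME
# in Kato currency: the crux ⟺ its `∀ ε` twin ⟺ Kato's Eisenstein half on every signed Coleman–Kato package at
# every large-image X7 pair — modulo four published named facts

HONEST FRAMING (cell `bsd-ssimc`, seat `bsd-line-slh-p1` LEAD gen 4, line of record `kurihara_rigidity`): TOOL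
THEOREMS ONLY — no definition, no named fact minted, no `sorry`, axioms standard. Every statement here is an
EQUIVALENCE or an implication ABOUT the crux `KobayashiLowerHalfLargeImage` (imported from the route file by
name), CONDITIONAL on the displayed published facts `h12` (Kobayashi 2003 Thm. 1.2), `h5`/`h3` (period
comparisons), and `hJ` (Kobayashi's JOINT `±` Coleman–Kato package, `thm62_63_73_signedColemanKato_zetaJoint`)
or its one-sign projection `hPkg` (`thm62_63_73_signedColemanKato_zeta`). The crux is NOT proved, in either
direction of any `iff`; the item, the line and the route stay OPEN; no summit statement is proved by this
seat; BSD is not proved by any of this. `--supports stmt-BirchSwinnertonDyer-19001` (never an input to a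
registered stub, to `closes`, or to a by-name close of the item).

WHAT (pointwise seams: `Theorems/…LargeImageSignDefectX7.lean`, this seat; class-blind algebra:
`Theorems/…SemistableSignDefect.lean`, seat `bsd-line-slh-p2`):
* `kobayashiLowerHalfLargeImage_iff_forall_sign` — granted `h12`/`h5`/`h3`/`hJ`: the crux (`… → ∃ ε,
  KobayashiLowerDivisibility W p ε`) ⟺ the same with `∀ ε`. The existential sign of item 19001 is IDLE: a
  line may conclude either sign, and the engines of line `kurihara_rigidity` (which give Kobayashi's main
  conjecture for EVERY sign) lose nothing when the skeleton picks `ε = 1`.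
* `kobayashiLowerHalfLargeImage_iff_katoEisenstein` — granted `h12`/`h5`/`h3`/`hJ`: the crux ⟺ «at every pair
  (`p` odd, X7, non-CM, `a_p = 0`, `ρ̄` onto), for every frame, every pinned `I = 𝐇¹(T)^Δ`, every fine dual `Y`
  and every signed package `d` of either sign, `char_Λ X₀ ⊆ char_Λ(𝐇¹/Z)`» — Kato's Conjecture 12.10,
  Eisenstein (lower) half, on the `Δ`-trivial package: the SAME currency as crux 2 on X6
  (`SignDefect.X6.kobayashiLowerDivisibility_iff_katoEisenstein`) and as the line's engines (Kim 2026 Thm. 1.11,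
  Castella–Sano 2026 Thm. 1, Kim–Kim–Sun 2020 Thm. 1.1 all conclude Kato's main conjecture).
* `kobayashiLowerHalfLargeImage_of_katoEisenstein` — the supply direction with the WEAKER one-sign package fact
  `hPkg`: Kato's Eisenstein inclusion on the sign-`+1` packages at every large-image X7 pair ⟹ the crux.
Image hypothesis: `Surj` is carried only because the crux carries it — the seams need `E[p]` irreducible,
automatic on X7 at odd `p` (`ClassX7.irr`); the same three theorems hold verbatim with `Surj` deleted on both
sides (then they speak of cruxes 3 and 4's lower halves together).

References: [Kobayashi2003] Thm. 1.2 (p. 2), Thm. 5.2 iv) (p. 9), Thm. 6.2/6.3 (p. 11), Thm. 7.3 i) (7.21), Thm.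
7.4 and its proof (p. 13); [Kato2004Asterisque] Conj. 12.10 (p. 224); [GreenbergVatsal2000] §3 Rem. 3.4;
[Serre1972] §1.11 Prop. 12.
-/

set_option autoImplicit false
-- single-problem summit (D-0017): the doubled namespace component is by design
set_option linter.dupNamespace false

noncomputable section

open scoped Classical MatrixGroups ModularForm

open CongruenceSubgroup Field WeierstrassCurve Literature.NumberTheory.EllipticCurves
  Literature.NumberTheory.EllipticCurves.ModularForms Literature.NumberTheory.GaloisRepresentations
  Literature.NumberTheory.EllipticCurves.Rank1Residual
  Literature.NumberTheory.EllipticCurves.Rank1Residual.Typed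
  Summit.BirchSwinnertonDyer.Rank1Residual.Supersingular
  Summit.BirchSwinnertonDyer.BirchSwinnertonDyer.Theses.SignedLowerHalves

namespace Summit.BirchSwinnertonDyer.BirchSwinnertonDyer.Theorems.LargeImageSignDefect

/-- **The existential sign of crux 3 is idle** (granted BY NAME Kobayashi Thm. 1.2 `h12`, the period facts
`h5`/`h3`, and the joint package fact `hJ`): `KobayashiLowerHalfLargeImage` — «for every `p ≠ 2`, X7, non-CM,
`a_p = 0`, `ρ̄` onto: `∃ ε, KobayashiLowerDivisibility W p ε`» — is equivalent to the same sentence with `∀ ε`.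
Pair by pair this is `SignDefect.X7.exists_kobayashiLowerDivisibility_iff_forall`. Conditional; the crux is not
proved. [cite: Kobayashi2003, Thm. 5.2 iv) (p. 9), Thm. 7.4 and its proof (p. 13)] -/
theorem kobayashiLowerHalfLargeImage_iff_forall_sign
    (h12 : Kobayashi2003.thm12_signedSelmerDual_finite_torsion)
    (h5 : realPeriodRat_eq_unit_mul_plusPeriod) (h3 : realPeriodRat_eq_unit_mul_plusPeriod_three)
    (hJ : Kobayashi2003.thm62_63_73_signedColemanKato_zetaJoint) :
    KobayashiLowerHalfLargeImage ↔
    ∀ (W : WeierstrassCurve ℚ) [W.IsElliptic] [W.IsGloballyMinimal] (p : ℕ) [Fact p.Prime],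
      p ≠ 2 → ClassX7 W p → ¬ W.HasCM → W.frobeniusTrace p = 0 → Surj W p →
      ∀ ε : ℤˣ, KobayashiLowerDivisibility W p ε := by
  constructor
  · intro h W _ _ p _ hp hX hcm hap hs
    exact (SignDefect.X7.exists_kobayashiLowerDivisibility_iff_forall W p h12 h5 h3 hJ hp hX hap).mp
      (h W p hp hX hcm hap hs)
  · intro h W _ _ p _ hp hX hcm hap hs
    exact ⟨1, h W p hp hX hcm hap hs 1⟩

/-- **Crux 3 in Kato currency** (granted BY NAME `h12`, `h5`/`h3`, `hJ`): `KobayashiLowerHalfLargeImage` ⟺ «at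
every pair (`p ≠ 2`, X7, non-CM, `a_p = 0`, `ρ̄` onto), for every cyclotomic frame `(κ, γ)`, the newform `f` and
period ratio `ϖ`, every sign `ε`, every pinned `I : Kato2004.IwasawaH1Data W p κ γ`, every fine dual `Y` and
every sign-`ε` Coleman–Kato package `d` on `I`: `char_Λ Y.X ⊆ char_Λ (I.H ⧸ d.Z)`» — Kato's Conjecture 12.10,
Eisenstein half, on the `Δ`-trivial package (the Tate-module instances are binders, as in the package facts;
they are kernel theorems, discharged inside `SignDefect.X7.…_allSigns`). Conditional; the crux is not proved.
[cite: Kobayashi2003, Thm. 7.4 and its proof (p. 13)] [cite: Kato2004Asterisque, Conj. 12.10 (p. 224)] -/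
theorem kobayashiLowerHalfLargeImage_iff_katoEisenstein
    (h12 : Kobayashi2003.thm12_signedSelmerDual_finite_torsion)
    (h5 : realPeriodRat_eq_unit_mul_plusPeriod) (h3 : realPeriodRat_eq_unit_mul_plusPeriod_three)
    (hJ : Kobayashi2003.thm62_63_73_signedColemanKato_zetaJoint) :
    KobayashiLowerHalfLargeImage ↔
    ∀ (W : WeierstrassCurve ℚ) [W.IsElliptic] [W.IsGloballyMinimal] (p : ℕ) [Fact p.Prime],
      p ≠ 2 → ClassX7 W p → ¬ W.HasCM → W.frobeniusTrace p = 0 → Surj W p →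
    ∀ [ContinuousSMul ℤ_[p] (W.tateModule p)] [Module.Free ℤ_[p] (W.tateModule p)]
      [Module.Finite ℤ_[p] (W.tateModule p)],
    ∀ (κ : ZpExtension ℚ p) (γ : absoluteGaloisGroup ℚ),
      κ.IsCyclotomic → κ.IsTopGenerator γ → IsCyclotomicVariable p γ →
    ∀ [NeZero (W.conductorNorm ℤ)] (f : CuspForm (Gamma0 (W.conductorNorm ℤ)) 2),
      IsNewformOf W f → ∀ (ϖ : ℚ), (ϖ : ℝ) * W.realPeriodRat = plusPeriod f →
    ∀ (ε : ℤˣ) (I : Kato2004.IwasawaH1Data W p κ γ) (Y : W.FineSelmerDualData κ γ)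
      (d : Kobayashi2003.SignedColemanKatoData W p f ϖ κ γ ε I),
      Module.charIdeal (IwasawaAlgebra p) Y.X ≤ Module.charIdeal (IwasawaAlgebra p) (I.H ⧸ d.Z) := by
  constructor
  · intro h W _ _ p _ hp hX hcm hap hs
    obtain ⟨ε, hε⟩ := h W p hp hX hcm hap hs
    exact (SignDefect.X7.kobayashiLowerDivisibility_iff_katoEisenstein_allSigns W p h12 h5 h3 hJ hp hX
      hap ε).mp hε
  · intro h W _ _ p _ hp hX hcm hap hs
    exact ⟨1, (SignDefect.X7.kobayashiLowerDivisibility_iff_katoEisenstein_allSigns W p h12 h5 h3 hJ hp hX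
      hap 1).mpr (h W p hp hX hcm hap hs)⟩

/-- **Supply direction with the one-sign package fact** (granted BY NAME `h12`, `h5`/`h3` and the WEAKER
`hPkg = thm62_63_73_signedColemanKato_zeta`; no jointness needed): if at every pair (`p ≠ 2`, X7, non-CM,
`a_p = 0`, `ρ̄` onto) Kato's Eisenstein inclusion `char_Λ X₀ ⊆ char_Λ(𝐇¹/Z)` holds on every sign-`+1` package
at every frame (Tate-module instances bound), then `KobayashiLowerHalfLargeImage` (with `ε = 1`). This is the
shape in which an engine concluding Kato's main conjecture (or only its Eisenstein half) feeds item 19001.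
Conditional; nothing is asserted about any curve. [cite: Kobayashi2003, Thm. 7.4 and its proof (p. 13)]
[cite: Kato2004Asterisque, Conj. 12.10 (p. 224)] -/
theorem kobayashiLowerHalfLargeImage_of_katoEisenstein
    (h12 : Kobayashi2003.thm12_signedSelmerDual_finite_torsion)
    (h5 : realPeriodRat_eq_unit_mul_plusPeriod) (h3 : realPeriodRat_eq_unit_mul_plusPeriod_three)
    (hPkg : Kobayashi2003.thm62_63_73_signedColemanKato_zeta)
    (h : ∀ (W : WeierstrassCurve ℚ) [W.IsElliptic] [W.IsGloballyMinimal] (p : ℕ) [Fact p.Prime],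
      p ≠ 2 → ClassX7 W p → ¬ W.HasCM → W.frobeniusTrace p = 0 → Surj W p →
    ∀ [ContinuousSMul ℤ_[p] (W.tateModule p)] [Module.Free ℤ_[p] (W.tateModule p)]
      [Module.Finite ℤ_[p] (W.tateModule p)],
    ∀ (κ : ZpExtension ℚ p) (γ : absoluteGaloisGroup ℚ),
      κ.IsCyclotomic → κ.IsTopGenerator γ → IsCyclotomicVariable p γ →
    ∀ [NeZero (W.conductorNorm ℤ)] (f : CuspForm (Gamma0 (W.conductorNorm ℤ)) 2),
      IsNewformOf W f → ∀ (ϖ : ℚ), (ϖ : ℝ) * W.realPeriodRat = plusPeriod f →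
    ∀ (I : Kato2004.IwasawaH1Data W p κ γ) (Y : W.FineSelmerDualData κ γ)
      (d : Kobayashi2003.SignedColemanKatoData W p f ϖ κ γ 1 I),
      Module.charIdeal (IwasawaAlgebra p) Y.X ≤ Module.charIdeal (IwasawaAlgebra p) (I.H ⧸ d.Z)) :
    KobayashiLowerHalfLargeImage := by
  intro W _ _ p _ hp hX hcm hap hs
  haveI : ContinuousSMul ℤ_[p] (W.tateModule p) := TateModule.continuousSMul_padicInt
  haveI : Module.Free ℤ_[p] (W.tateModule p) := W.module_free_tateModule_holds p
  haveI : Module.Finite ℤ_[p] (W.tateModule p) := W.module_finite_tateModule_holds p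
  exact ⟨1, (SignDefect.X7.kobayashiLowerDivisibility_iff_katoEisenstein W p h12 h5 h3 hPkg hp hX hap 1).mpr
    fun κ γ hκ hγ hv _ f hf ϖ hϖ I Y d ↦ h W p hp hX hcm hap hs κ γ hκ hγ hv f hf ϖ hϖ I Y d⟩

end Summit.BirchSwinnertonDyer.BirchSwinnertonDyer.Theorems.LargeImageSignDefect

end
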